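import Summits.BirchSwinnertonDyer.BirchSwinnertonDyer.Theorems.ResidualThetaTransportAtTwoAwayDefs
import Summits.BirchSwinnertonDyer.BirchSwinnertonDyer.Theorems.ResidualThetaTransportAtTwoResidualSignedLambdaLowerCMAtTwoPlusPair
import Summits.BirchSwinnertonDyer.BirchSwinnertonDyer.Theorems.ResidualThetaTransportAtTwoResidualSignedLambdaLowerCMAtTwoCofreeSelmerTransferRelaxedAtTwo
import Summits.BirchSwinnertonDyer.BirchSwinnertonDyer.Theorems.ResidualThetaTransportAtTwoResidualSignedLambdaLowerCMAtTwoRhoLayerPairingGlueAwayTwo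
import Literature.NumberTheory.GaloisRepresentations.AbsGaloisGroupCompact
import HarnessLib

/-!
# Stub-ideation sketch `sidea-stub_cmLambdaLower-3-g17` (k = 3, technique = decomposition)

Crux `ResidualThetaCountLowerPureAtTwo` (stmt-BirchSwinnertonDyer-26074), registered stub `stub_cmLambdaLower` of skeleton
`Lines/bt26_lambda.lean` v6 = BY NAME the route item RSL_g `ResidualSignedLambdaLowerCMAtTwo` (stmt-22608), whose skeleton of record is
`Cruxes/ResidualSignedLambdaLowerCMAtTwo/Lines/onepair.lean` v2f.  The EH / S4₂ split texts of `stub_onePairSupply` (desk g18) are stated over a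
binder `π₂ : OnePair.AtTwoPins … π` (p698991, born 2026-08-29T05:23Z): THE local value character `c₂ : 𝔉₂ →+ CharacterModule D₂` pinned on local
Θ-Kummer data.  `onePairSupply_of_split` must INSTANTIATE that binder, i.e. somebody must prove `Nonempty (AtTwoPins … π)`.

THIS FILE (kernel-checked, 0 sorries, 0 warnings) PROVES that instantiation OUTRIGHT on the habitat and decomposes it on the way
(GLUE-SPEC-g18 §1 package T1 (a)(b) + the generic half of T2 (a) + the `c₂` half of T1 (f)):
* §1 generic descent of a datum-defined value to a biadditive map `F →+ D →+ V` (+ uniqueness);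
* §2 `LocalKummerDatum` = the local Θ-Kummer datum at `v ∣ 2` in the currency of `AtTwoPins.hc₂` VERBATIM, its class `cls` and level value `val`;
  H3loc additivity of data; the finite exponent of a LOCAL cocycle (compactness of `U_{∞,v}`); H4loc the `ι(a)`-scalar datum (`DlocSMul` on classes
  = `ι(a) ∘ ψ` on cocycles, `DlocSMul_oneCocycleClass`);
* §2b H2loc `val_eq_of_cls_eq` — the level value depends only on the local CLASS (Tate normalisation + `2^k`-torsion bookkeeping), LOCAL port of
  g17 `PlusValue.levelValue_eq_of_kummerData`;
* §2c H1loc `LocalKummerDatum.exists_cls_eq` — EVERY local class has a datum (GoodSS at 2, κ cyclotomic): LOCAL port of p695679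
  `exists_towerKummer_of_cocycle` through the equivariant coordinate morphisms `coordHom i : A_ρ| ⟶ E(K̄_v)` and §0 of p695679;
* §2d (O-inst) `dlocModule` — the binder `ℤ₂`-structure on `D_w` with `a • y = DlocSMul (ι a) y` CONSTRUCTED (a reducible `def`, never an
  instance) for EVERY place `w` (so also T2 (a) at `w ∈ S₀`), pin `hD₂` by `rfl`;
* §3 packaging `nonempty_atTwoPins_of_parts : hD₂ → H1loc → H2loc → Nonempty (AtTwoPins … π)`, `nonempty_atTwoPins` (given `hD₂`), and the
  binder-free bottom line `nonempty_atTwoPins_dlocModule : GoodSS W 2 → κ.IsCyclotomic → Nonempty (letI := dlocModule …; AtTwoPins … π)`;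
* §4 `c₂` is UNIQUE (`atTwoPins_subsingleton_c₂`), and its value on any datum (`atTwoPins_c₂_apply`);
* §5 T1 (f) `c₂` half: `atTwoPins_c₂_locKer_eq` — on `loc₂ [φ]` (bridge p700007 `locKer_oneCocycleClass`) `c₂` takes the S2 VALUE of any GLOBAL
  tower-Kummer datum `(φ, Q, k)`.
BSD is NOT proved by any of this; RSL_g (22608) and (R≥)ᵖ (26074) stay OPEN; nothing here is a route item or a Theorems proposal.
-/

set_option autoImplicit false
set_option linter.dupNamespace false

noncomputable section

open scoped Classical

namespace Summit.BirchSwinnertonDyer.BirchSwinnertonDyer.Cruxes.ResidualThetaCountLowerPureAtTwo.SideaK3G17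

/-! ## §1 Generic descent: a value defined on DATA of classes descends to a biadditive map (the pattern inlined in `PlusValue.exists_plusPair`) -/

section Descent

variable {F D Δ V : Type*} [AddCommGroup F] [AddCommGroup D] [AddCommGroup V]

/-- **GENERIC DESCENT.** `rel y δ` = "`δ` is a datum of the class `y`", `val t δ` = the value read on the datum. If every class has a datum
(`hex`), the value is datum-independent (`hwd`), data add with additive values (`hadd`) and the value is additive in `t` on a fixed datum
(`haddt`), then there is a biadditive `c : F →+ D →+ V` evaluating to `val t δ` on EVERY datum `δ` of `y`. [folklore] -/
theorem exists_biadditive_of_datum (rel : D → Δ → Prop) (val : F → Δ → V)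
    (hex : ∀ y, ∃ δ, rel y δ)
    (hwd : ∀ t y δ δ', rel y δ → rel y δ' → val t δ = val t δ')
    (hadd : ∀ y y' δ δ', rel y δ → rel y' δ' → ∃ δ'', rel (y + y') δ'' ∧ ∀ t, val t δ'' = val t δ + val t δ')
    (haddt : ∀ t t' y δ, rel y δ → val (t + t') δ = val t δ + val t' δ) :
    ∃ c : F →+ D →+ V, ∀ t y δ, rel y δ → c t y = val t δ := by
  choose dat hdat using hex
  have hy : ∀ t y y', val t (dat (y + y')) = val t (dat y) + val t (dat y') := fun t y y' => by
    obtain ⟨δ'', h'', hv⟩ := hadd y y' (dat y) (dat y') (hdat y) (hdat y')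
    rw [hwd t (y + y') (dat (y + y')) δ'' (hdat _) h'', hv]
  refine ⟨AddMonoidHom.mk' (fun t => AddMonoidHom.mk' (fun y => val t (dat y)) (hy t))
    (fun t t' => AddMonoidHom.ext fun y => haddt t t' y (dat y) (hdat y)), fun t y δ h => ?_⟩
  show val t (dat y) = val t δ
  exact hwd t y (dat y) δ (hdat y) h

/-- **UNIQUENESS of the descended map**: two biadditive maps with the datum evaluation rule agree (every class has a datum). [folklore] -/
theorem biadditive_eq_of_datum (rel : D → Δ → Prop) (val : F → Δ → V) (hex : ∀ y, ∃ δ, rel y δ) (c c' : F →+ D →+ V)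
    (hc : ∀ t y δ, rel y δ → c t y = val t δ) (hc' : ∀ t y δ, rel y δ → c' t y = val t δ) : c = c' :=
  AddMonoidHom.ext fun t => AddMonoidHom.ext fun y => (hex y).elim fun δ h => (hc t y δ h).trans (hc' t y δ h).symm

end Descent

/-! ## §2 Local Θ-Kummer data at `v ∣ 2` — the currency of `OnePair.AtTwoPins.hc₂` (LOCAL cocycles `ψ` of `U_{∞,v} = kerGroup κ v`) -/

section Local

open Summit.BirchSwinnertonDyer.BirchSwinnertonDyer.Theorems Summit.BirchSwinnertonDyer.BirchSwinnertonDyer.Theorems.OnePair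
open Literature.NumberTheory.EllipticCurves Literature.NumberTheory.EllipticCurves.GreenbergSelmer
open Literature.NumberTheory.GaloisRepresentations NumberField IsDedekindDomain Field
open Literature.NumberTheory.EllipticCurves GreenbergSelmer Kobayashi2003 Literature.NumberTheory.GaloisRepresentations
  IsDedekindDomain NumberField Field Rat.HeightOneSpectrum PowerSeries
open Literature.NumberTheory.EllipticCurves.CyclotomicLayer CategoryTheory

variable (S : Set (PadicAlgCl 2)) (κ : ZpExtension ℚ 2) (ρ : FramedGaloisRep ℚ ↥(padicCoeffIntegers S) 2)
  (W : WeierstrassCurve ℚ) (n : ℕ)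
  (Θ : ∀ v : HeightOneSpectrum (𝓞 ℚ), ((2 : ℕ) : 𝓞 ℚ) ∈ v.asIdeal → (Cofree ρ ↥(padicCoeffField S) ≃+ (Fin n → ↥(W.geomPrimaryTorsion 2))))
  (v : HeightOneSpectrum (𝓞 ℚ)) (hv : ((2 : ℕ) : 𝓞 ℚ) ∈ v.asIdeal)

/-- **A local Θ-Kummer datum at `v`**: a LOCAL cocycle `ψ` of `U_{∞,v}` with values in `A_ρ`, a tuple `Q ∈ E(ℚ_v)ⁿ` with `2^k Q ∈ E(ℚ_{∞,v})ⁿ`,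
and the Θ-Kummer formula `ι_*Θ(ψ τ)_i = τQ_i − Q_i` on `U_{∞,v}` — EXACTLY the binders `(ψ, Q, k, hQ, _, hK)` of `AtTwoPins.hc₂`.
[cite: Kobayashi2003, (8.23) (p. 18)] [cite: MilneADT2006, Ch. I §6] -/
structure LocalKummerDatum where
  /-- the local cocycle -/
  ψ : contOneCocycles (subgroupRep (localRepOf (cofreeGaloisModule S ρ) v) (kerGroup κ v))
  /-- the Kummer tuple -/
  Q : Fin n → localPoints W (v.adicCompletion ℚ)
  /-- the level -/
  k : ℕ
  hQ : ∀ i, (2 ^ k) • Q i ∈ Sprung2012.localTowerPointsOfEmb κ (closureEmb (K := ℚ) (v.adicCompletion ℚ)) W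
  hK : ∀ (τ : ↥(kerGroup κ v)) (i : Fin n), pointsMapOfEmb W (closureEmb (K := ℚ) (v.adicCompletion ℚ))
      ((Θ v hv (ψ.1 τ) i : ↥(W.geomPrimaryTorsion 2)) : W.geomPoints) = (τ : absoluteGaloisGroup (v.adicCompletion ℚ)) • Q i - Q i

variable {S κ ρ W n Θ v hv}

namespace LocalKummerDatum

/-- The local class `[ψ] ∈ D_v = H¹(ℚ_{∞,v}, A_ρ)` a datum represents. [cite: Kobayashi2003, (8.23) (p. 18)] -/
def cls (δ : LocalKummerDatum S κ ρ W n Θ v hv) : Dloc S κ ρ v :=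
  oneCocycleClass (subgroupRep (localRepOf (cofreeGaloisModule S ρ) v) (kerGroup κ v)) δ.ψ

/-- The LEVEL VALUE of a datum against `t ∈ 𝔉₂`: `(t(2^k Q) mod 2^k) · 2^{-k} ∈ ℚ/ℤ` — the right-hand side of `AtTwoPins.hc₂` verbatim.
[cite: Kobayashi2003, (8.23) (p. 18)] -/
def val (δ : LocalKummerDatum S κ ρ W n Θ v hv)
    (t : (Fin n → ↥(Sprung2012.localTowerPointsOfEmb κ (closureEmb (K := ℚ) (v.adicCompletion ℚ)) W)) →+ ℤ_[2]) : AddCircle (1 : ℚ) :=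
  (PadicInt.toZModPow δ.k (t (fun i => ⟨(2 ^ δ.k) • δ.Q i, δ.hQ i⟩))).val • ((((2 : ℚ) ^ δ.k)⁻¹ : ℚ) : AddCircle (1 : ℚ))

/-- Additivity of the level value in `t` (fixed datum). [folklore] -/
theorem val_add (δ : LocalKummerDatum S κ ρ W n Θ v hv)
    (t t' : (Fin n → ↥(Sprung2012.localTowerPointsOfEmb κ (closureEmb (K := ℚ) (v.adicCompletion ℚ)) W)) →+ ℤ_[2]) :
    δ.val (t + t') = δ.val t + δ.val t' := by
  unfold val
  rw [AddMonoidHom.add_apply]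
  exact PlusValue.levelValue_add (p := 2) δ.k _ _

/-- **H3loc (PROVED): local Θ-Kummer data ADD** — `(ψ + ψ', Q + Q', k + k')`. [cite: Kobayashi2003, (8.23) (p. 18)] -/
def add (δ δ' : LocalKummerDatum S κ ρ W n Θ v hv) : LocalKummerDatum S κ ρ W n Θ v hv where
  ψ := δ.ψ + δ'.ψ
  Q := fun i => δ.Q i + δ'.Q i
  k := δ.k + δ'.k
  hQ := fun i => by
    rw [smul_add]
    refine add_mem ?_ ?_
    · rw [pow_add, mul_comm, mul_smul]
      exact AddSubgroup.nsmul_mem _ (δ.hQ i) _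
    · rw [pow_add, mul_smul]
      exact AddSubgroup.nsmul_mem _ (δ'.hQ i) _
  hK := fun τ i => by
    rw [Submodule.coe_add, ContinuousMap.add_apply, map_add, Pi.add_apply, AddMemClass.coe_add, map_add, δ.hK τ i, δ'.hK τ i, smul_add]
    abel

/-- The sum datum represents the sum class. [folklore] -/
theorem cls_add (δ δ' : LocalKummerDatum S κ ρ W n Θ v hv) : (δ.add δ').cls = δ.cls + δ'.cls :=
  oneCocycleClass_add _ _ _

/-- The level value of the sum datum is the sum of the level values (`levelValue_add` + `levelValue_mul_pow`). [cite: Kobayashi2003, (8.23) (p. 18)] -/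
theorem add_val (δ δ' : LocalKummerDatum S κ ρ W n Θ v hv)
    (t : (Fin n → ↥(Sprung2012.localTowerPointsOfEmb κ (closureEmb (K := ℚ) (v.adicCompletion ℚ)) W)) →+ ℤ_[2]) :
    (δ.add δ').val t = δ.val t + δ'.val t := by
  have hid : (fun i => (⟨(2 ^ (δ.k + δ'.k)) • (δ.Q i + δ'.Q i), (δ.add δ').hQ i⟩ :
        ↥(Sprung2012.localTowerPointsOfEmb κ (closureEmb (K := ℚ) (v.adicCompletion ℚ)) W))) =
      (2 ^ δ'.k) • (fun i => (⟨(2 ^ δ.k) • δ.Q i, δ.hQ i⟩ : ↥(Sprung2012.localTowerPointsOfEmb κ (closureEmb (K := ℚ) (v.adicCompletion ℚ)) W))) +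
        (2 ^ δ.k) • (fun i => (⟨(2 ^ δ'.k) • δ'.Q i, δ'.hQ i⟩ : ↥(Sprung2012.localTowerPointsOfEmb κ (closureEmb (K := ℚ) (v.adicCompletion ℚ)) W))) := by
    funext i
    apply Subtype.ext
    simp only [Pi.add_apply, Pi.smul_apply, AddMemClass.coe_add, AddSubgroupClass.coe_nsmul]
    rw [smul_add, smul_smul, smul_smul, ← pow_add, ← pow_add, add_comm δ'.k δ.k]
  show (PadicInt.toZModPow (δ.k + δ'.k) (t (fun i => ⟨(2 ^ (δ.k + δ'.k)) • (δ.Q i + δ'.Q i), (δ.add δ').hQ i⟩))).val •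
      ((((2 : ℚ) ^ (δ.k + δ'.k))⁻¹ : ℚ) : AddCircle (1 : ℚ)) = δ.val t + δ'.val t
  unfold val
  rw [hid, map_add, map_nsmul, map_nsmul, nsmul_eq_mul, nsmul_eq_mul, Nat.cast_pow, Nat.cast_pow]
  have h1 := PlusValue.levelValue_add (p := 2) (δ.k + δ'.k) ((2 : ℕ) ^ δ'.k * t (fun i => ⟨(2 ^ δ.k) • δ.Q i, δ.hQ i⟩))
    ((2 : ℕ) ^ δ.k * t (fun i => ⟨(2 ^ δ'.k) • δ'.Q i, δ'.hQ i⟩))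
  have h2 := PlusValue.levelValue_mul_pow (p := 2) δ.k δ'.k (t (fun i => ⟨(2 ^ δ.k) • δ.Q i, δ.hQ i⟩))
  have h3 := PlusValue.levelValue_mul_pow (p := 2) δ'.k δ.k (t (fun i => ⟨(2 ^ δ'.k) • δ'.Q i, δ'.hQ i⟩))
  rw [add_comm δ'.k δ.k] at h3
  simp only [Nat.cast_ofNat] at h1 h2 h3 ⊢
  rw [h1, h2, h3]

end LocalKummerDatum

/-- **Finite exponent of a LOCAL cocycle** (local twin of `PlusValue.exists_pow_smul_cocycle_eq_zero`): `U_{∞,v}` is compact (closed preimage of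
`Γ_∞` in `Γ_{ℚ_v}`), `A_ρ` is discrete torsion, so one power of `2` kills all values. [cite: SerreGaloisCohomology1997, I §2.2] -/
theorem exists_pow_smul_localCocycle_eq_zero (Θv : Cofree ρ ↥(padicCoeffField S) ≃+ (Fin n → ↥(W.geomPrimaryTorsion 2)))
    (ψ : contOneCocycles (subgroupRep (localRepOf (cofreeGaloisModule S ρ) v) (kerGroup κ v))) :
    ∃ E : ℕ, ∀ g : ↥(kerGroup κ v), (2 ^ E) • ψ.1 g = 0 := by
  have hcl : IsClosed ((kerGroup κ v : Subgroup (absoluteGaloisGroup (v.adicCompletion ℚ))) : Set (absoluteGaloisGroup (v.adicCompletion ℚ))) :=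
    κ.isClosed_kerSubgroup.preimage (map_continuous (resGalOfEmb (closureEmb (K := ℚ) (v.adicCompletion ℚ))))
  haveI : CompactSpace (absoluteGaloisGroup (v.adicCompletion ℚ)) := absoluteGaloisGroup_compactSpace _
  haveI : CompactSpace ↥(kerGroup κ v) := isCompact_iff_compactSpace.mp hcl.isCompact
  have hfin : (Set.range (ψ.1 : ↥(kerGroup κ v) → Cofree ρ ↥(padicCoeffField S))).Finite :=
    (isCompact_range ψ.1.continuous).finite_of_discrete
  choose e he using fun a : Cofree ρ ↥(padicCoeffField S) => PlusValue.exists_pow_smul_cofree_eq_zero W Θv a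
  refine ⟨hfin.toFinset.sup e, fun g => ?_⟩
  obtain ⟨c, hc⟩ := Nat.exists_eq_add_of_le (Finset.le_sup (f := e) (hfin.mem_toFinset.mpr ⟨g, rfl⟩))
  rw [hc, pow_add, mul_comm, mul_smul, he, smul_zero]

/-- The scaled local cocycle `ι(a) ∘ ψ` (pull-back along the identity of the `H¹`-functoriality morphism of `cofreeLocalScalar`). [cite: Greenberg1989, §1 p. 98] -/
def smulCocycle (a : ↥(padicCoeffIntegers S)) (ψ : contOneCocycles (subgroupRep (localRepOf (cofreeGaloisModule S ρ) v) (kerGroup κ v))) :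
    contOneCocycles (subgroupRep (localRepOf (cofreeGaloisModule S ρ) v) (kerGroup κ v)) :=
  contOneCocycles.pullback (ContinuousMonoidHom.id _)
    (resIdHom (subgroupRepMap (Y := localRepOf (cofreeGaloisModule S ρ) v) (cofreeLocalScalar S ρ a v) (kerGroup κ v))) ψ

/-- Values of the scaled cocycle: `(ι(a) ∘ ψ)(τ) = a • ψ(τ)`. [folklore] -/
theorem smulCocycle_apply (a : ↥(padicCoeffIntegers S)) (ψ : contOneCocycles (subgroupRep (localRepOf (cofreeGaloisModule S ρ) v) (kerGroup κ v)))
    (τ : ↥(kerGroup κ v)) : (smulCocycle (κ := κ) (v := v) a ψ).1 τ = a • ψ.1 τ := rfl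

/-- `H¹` of the scalar `a` sends `[ψ]` to `[ι(a) ∘ ψ]` (`cohomologyMap_oneCocycleClass`). [folklore] -/
theorem DlocSMul_oneCocycleClass (a : ↥(padicCoeffIntegers S))
    (ψ : contOneCocycles (subgroupRep (localRepOf (cofreeGaloisModule S ρ) v) (kerGroup κ v))) :
    DlocSMul S κ ρ v a (oneCocycleClass _ ψ) = oneCocycleClass _ (smulCocycle (κ := κ) (v := v) a ψ) :=
  cohomologyMap_oneCocycleClass _ ψ

/-- **H4loc (PROVED): the `ℤ₂`-scalar datum.** A datum `(ψ, Q, k)` of `y` yields the datum `(ι(a)∘ψ, N•Q, k)`, `N = a mod 2^{E+k}` (`2^E ψ = 0`), of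
`ι(a)_* y`, whose level value against `t` is that of `(ψ, Q, k)` against `a • t`. [cite: Kobayashi2003, (8.23) (p. 18)] [folklore] -/
theorem LocalKummerDatum.exists_smul (a : ℤ_[2])
    (t : (Fin n → ↥(Sprung2012.localTowerPointsOfEmb κ (closureEmb (K := ℚ) (v.adicCompletion ℚ)) W)) →+ ℤ_[2])
    (δ : LocalKummerDatum S κ ρ W n Θ v hv) :
    ∃ δ' : LocalKummerDatum S κ ρ W n Θ v hv, δ'.cls = DlocSMul S κ ρ v (padicIntToCoeffIntegers S a) δ.cls ∧ δ'.val t = δ.val (a • t) := by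
  obtain ⟨E, hE⟩ := exists_pow_smul_localCocycle_eq_zero (κ := κ) (v := v) (Θ v hv) δ.ψ
  have hE' : ∀ g, (2 ^ (E + δ.k)) • δ.ψ.1 g = 0 := fun g => by rw [pow_add, mul_comm, mul_smul, hE g, smul_zero]
  have hQc : ∀ i, (2 ^ δ.k) • ((PadicInt.toZModPow (E + δ.k) a).val • δ.Q i) ∈
      Sprung2012.localTowerPointsOfEmb κ (closureEmb (K := ℚ) (v.adicCompletion ℚ)) W := fun i => by
    rw [smul_comm]
    exact AddSubgroup.nsmul_mem _ (δ.hQ i) _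
  have hKc : ∀ (τ : ↥(kerGroup κ v)) (i : Fin n), pointsMapOfEmb W (closureEmb (K := ℚ) (v.adicCompletion ℚ))
      ((Θ v hv ((smulCocycle (κ := κ) (v := v) (padicIntToCoeffIntegers S a) δ.ψ).1 τ) i : ↥(W.geomPrimaryTorsion 2)) : W.geomPoints) =
      (τ : absoluteGaloisGroup (v.adicCompletion ℚ)) • ((PadicInt.toZModPow (E + δ.k) a).val • δ.Q i) -
        (PadicInt.toZModPow (E + δ.k) a).val • δ.Q i := fun τ i => by
    rw [smulCocycle_apply, PlusValue.coeff_smul_eq_nsmul_of_pow_smul_eq_zero a _ (E + δ.k) (hE' _), map_nsmul, Pi.smul_apply,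
      AddSubgroupClass.coe_nsmul, map_nsmul, δ.hK τ i, smul_sub, smul_comm]
  refine ⟨⟨smulCocycle (κ := κ) (v := v) (padicIntToCoeffIntegers S a) δ.ψ, fun i => (PadicInt.toZModPow (E + δ.k) a).val • δ.Q i, δ.k, hQc, hKc⟩,
    (DlocSMul_oneCocycleClass (κ := κ) (v := v) (padicIntToCoeffIntegers S a) δ.ψ).symm, ?_⟩
  have hid : (fun i => (⟨(2 ^ δ.k) • ((PadicInt.toZModPow (E + δ.k) a).val • δ.Q i), hQc i⟩ :
        ↥(Sprung2012.localTowerPointsOfEmb κ (closureEmb (K := ℚ) (v.adicCompletion ℚ)) W))) =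
      (PadicInt.toZModPow (E + δ.k) a).val • (fun i => (⟨(2 ^ δ.k) • δ.Q i, δ.hQ i⟩ :
        ↥(Sprung2012.localTowerPointsOfEmb κ (closureEmb (K := ℚ) (v.adicCompletion ℚ)) W))) := by
    funext i
    apply Subtype.ext
    simp only [Pi.smul_apply, AddSubgroupClass.coe_nsmul]
    rw [smul_comm]
  show (PadicInt.toZModPow δ.k (t (fun i => ⟨(2 ^ δ.k) • ((PadicInt.toZModPow (E + δ.k) a).val • δ.Q i), hQc i⟩))).val •
      ((((2 : ℚ) ^ δ.k)⁻¹ : ℚ) : AddCircle (1 : ℚ)) =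
    (PadicInt.toZModPow δ.k ((a • t) (fun i => ⟨(2 ^ δ.k) • δ.Q i, δ.hQ i⟩))).val • ((((2 : ℚ) ^ δ.k)⁻¹ : ℚ) : AddCircle (1 : ℚ))
  rw [hid, map_nsmul, AddMonoidHom.smul_apply]
  exact (PlusValue.levelValue_eq_of_toZModPow_eq (p := 2) δ.k (PlusValue.toZModPow_smul_eq_toZModPow_nsmul (p := 2) δ.k E a _)).symm


/-! ## §2b H2loc (PROVED): the level value is WELL DEFINED on a local class — LOCAL port of `PlusValue.levelValue_eq_of_kummerData` (p688548) -/

/-- **Two local Kummer representatives of one local class differ by a tower point** (local twin of `PlusValue.sub_sub_mem_localTowerPointsOfEmb`):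
if `ψ − ψ' = ∂a` on `U_{∞,v}` then `Q_i − Q'_i − ι_*Θ(a)_i ∈ E(ℚ_{∞,v})`. [cite: SilvermanAEC2009, VIII §2] [cite: MilneADT2006, Ch. I §6] -/
theorem sub_sub_mem_localTowerPointsOfEmb_local
    (hΘv : ∀ (δ : absoluteGaloisGroup (v.adicCompletion ℚ)) (m : Cofree ρ ↥(padicCoeffField S)) (i : Fin n),
      Θ v hv (resGalOfEmb (closureEmb (K := ℚ) (v.adicCompletion ℚ)) δ • m) i = resGalOfEmb (closureEmb (K := ℚ) (v.adicCompletion ℚ)) δ • Θ v hv m i)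
    (ψ ψ' : contOneCocycles (subgroupRep (localRepOf (cofreeGaloisModule S ρ) v) (kerGroup κ v))) (a : Cofree ρ ↥(padicCoeffField S))
    (ha : ∀ τ : ↥(kerGroup κ v), ψ.1 τ - ψ'.1 τ =
      resGalOfEmb (closureEmb (K := ℚ) (v.adicCompletion ℚ)) (τ : absoluteGaloisGroup (v.adicCompletion ℚ)) • a - a)
    (Q Q' : Fin n → localPoints W (v.adicCompletion ℚ))
    (hK : ∀ (τ : ↥(kerGroup κ v)) (i : Fin n), pointsMapOfEmb W (closureEmb (K := ℚ) (v.adicCompletion ℚ))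
      ((Θ v hv (ψ.1 τ) i : ↥(W.geomPrimaryTorsion 2)) : W.geomPoints) = (τ : absoluteGaloisGroup (v.adicCompletion ℚ)) • Q i - Q i)
    (hK' : ∀ (τ : ↥(kerGroup κ v)) (i : Fin n), pointsMapOfEmb W (closureEmb (K := ℚ) (v.adicCompletion ℚ))
      ((Θ v hv (ψ'.1 τ) i : ↥(W.geomPrimaryTorsion 2)) : W.geomPoints) = (τ : absoluteGaloisGroup (v.adicCompletion ℚ)) • Q' i - Q' i)
    (i : Fin n) :
    Q i - Q' i - pointsMapOfEmb W (closureEmb (K := ℚ) (v.adicCompletion ℚ)) ((Θ v hv a i : ↥(W.geomPrimaryTorsion 2)) : W.geomPoints) ∈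
      Sprung2012.localTowerPointsOfEmb κ (closureEmb (K := ℚ) (v.adicCompletion ℚ)) W := by
  rw [Sprung2012.mem_localTowerPointsOfEmb_iff]
  intro τ hτ
  have h1 := hK ⟨τ, hτ⟩ i
  have h2 := hK' ⟨τ, hτ⟩ i
  have h3 : ((Θ v hv (ψ.1 ⟨τ, hτ⟩) i : ↥(W.geomPrimaryTorsion 2)) : W.geomPoints) - ((Θ v hv (ψ'.1 ⟨τ, hτ⟩) i : ↥(W.geomPrimaryTorsion 2)) : W.geomPoints) =
      resGalOfEmb (closureEmb (K := ℚ) (v.adicCompletion ℚ)) τ • ((Θ v hv a i : ↥(W.geomPrimaryTorsion 2)) : W.geomPoints) -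
        ((Θ v hv a i : ↥(W.geomPrimaryTorsion 2)) : W.geomPoints) := by
    rw [← AddSubgroupClass.coe_sub, ← Pi.sub_apply, ← map_sub, ha, map_sub, Pi.sub_apply, AddSubgroupClass.coe_sub, hΘv]
    rfl
  have h4 := congrArg (pointsMapOfEmb W (closureEmb (K := ℚ) (v.adicCompletion ℚ))) h3
  rw [map_sub, h1, h2, map_sub, pointsMapOfEmb_smul] at h4
  rw [smul_sub, smul_sub]
  have h5 : τ • Q i - τ • Q' i - τ • pointsMapOfEmb W (closureEmb (K := ℚ) (v.adicCompletion ℚ)) ((Θ v hv a i : ↥(W.geomPrimaryTorsion 2)) : W.geomPoints) -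
      (Q i - Q' i - pointsMapOfEmb W (closureEmb (K := ℚ) (v.adicCompletion ℚ)) ((Θ v hv a i : ↥(W.geomPrimaryTorsion 2)) : W.geomPoints)) = 0 := by
    have := sub_eq_zero.mpr h4
    rw [← this]
    abel
  exact sub_eq_zero.mp h5

/-- **H2loc (PROVED): the level value does not depend on the LOCAL Kummer representative.** Two local data of one class in `D_v` give the same
level value against every `t`: `ψ − ψ' = ∂a` (`oneCocycleClass_eq_zero_iff` on the LOCAL representation, whose action is `resGalOfEmb ∘ closureEmb`
by `rfl`), `2^e Θ(a) = 0`, `R = Q − Q' − ι_*Θ a` is a tower point, and `2^{k'+e}·2^kQ − 2^{k+e}·2^{k'}Q' = 2^{k+k'+e} R`, so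
`PlusValue.levelValue_eq_of_pow_mul_sub_mem` applies. [cite: Kobayashi2003, (8.23) (p. 18)] [cite: MilneADT2006, Ch. I §6] -/
theorem LocalKummerDatum.val_eq_of_cls_eq
    (hΘv : ∀ (δ : absoluteGaloisGroup (v.adicCompletion ℚ)) (m : Cofree ρ ↥(padicCoeffField S)) (i : Fin n),
      Θ v hv (resGalOfEmb (closureEmb (K := ℚ) (v.adicCompletion ℚ)) δ • m) i = resGalOfEmb (closureEmb (K := ℚ) (v.adicCompletion ℚ)) δ • Θ v hv m i)
    (t : (Fin n → ↥(Sprung2012.localTowerPointsOfEmb κ (closureEmb (K := ℚ) (v.adicCompletion ℚ)) W)) →+ ℤ_[2])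
    (δ δ' : LocalKummerDatum S κ ρ W n Θ v hv) (h : δ.cls = δ'.cls) : δ.val t = δ'.val t := by
  have h0 : oneCocycleClass _ (δ.ψ - δ'.ψ) = 0 := by
    rw [oneCocycleClass_sub]
    exact sub_eq_zero.mpr h
  obtain ⟨a, ha⟩ := (oneCocycleClass_eq_zero_iff _ _).mp h0
  have ha' : ∀ τ : ↥(kerGroup κ v), δ.ψ.1 τ - δ'.ψ.1 τ =
      resGalOfEmb (closureEmb (K := ℚ) (v.adicCompletion ℚ)) (τ : absoluteGaloisGroup (v.adicCompletion ℚ)) • a - a := fun τ => by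
    have hτ := ha τ
    rw [Submodule.coe_sub, ContinuousMap.sub_apply] at hτ
    exact hτ
  obtain ⟨e, he⟩ := PlusValue.exists_pow_smul_theta_eq_zero W (Θ v hv) a
  obtain ⟨P, hP⟩ : ∃ P : Fin n → localPoints W (v.adicCompletion ℚ), ∀ i,
      P i = pointsMapOfEmb W (closureEmb (K := ℚ) (v.adicCompletion ℚ)) ((Θ v hv a i : ↥(W.geomPrimaryTorsion 2)) : W.geomPoints) :=
    ⟨_, fun _ => rfl⟩
  have hR : ∀ i, δ.Q i - δ'.Q i - P i ∈ Sprung2012.localTowerPointsOfEmb κ (closureEmb (K := ℚ) (v.adicCompletion ℚ)) W := fun i => by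
    rw [hP i]
    exact sub_sub_mem_localTowerPointsOfEmb_local hΘv δ.ψ δ'.ψ a ha' δ.Q δ'.Q δ.hK δ'.hK i
  have hPe : ∀ i, (2 ^ e) • P i = 0 := fun i => by rw [hP i, ← map_nsmul, he i, map_zero]
  have e1 : 2 ^ (δ'.k + e) * 2 ^ δ.k = 2 ^ (δ.k + δ'.k) * 2 ^ e := by ring
  have e2 : 2 ^ (δ.k + e) * 2 ^ δ'.k = 2 ^ (δ.k + δ'.k) * 2 ^ e := by ring
  have hid : (2 ^ (δ'.k + e)) • (fun i => (⟨(2 ^ δ.k) • δ.Q i, δ.hQ i⟩ : ↥(Sprung2012.localTowerPointsOfEmb κ (closureEmb (K := ℚ) (v.adicCompletion ℚ)) W))) -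
      (2 ^ (δ.k + e)) • (fun i => (⟨(2 ^ δ'.k) • δ'.Q i, δ'.hQ i⟩ : ↥(Sprung2012.localTowerPointsOfEmb κ (closureEmb (K := ℚ) (v.adicCompletion ℚ)) W))) =
      (2 ^ (δ.k + δ'.k + e)) • (fun i => (⟨δ.Q i - δ'.Q i - P i, hR i⟩ : ↥(Sprung2012.localTowerPointsOfEmb κ (closureEmb (K := ℚ) (v.adicCompletion ℚ)) W))) := by
    funext i
    apply Subtype.ext
    simp only [Pi.sub_apply, Pi.smul_apply, AddSubgroupClass.coe_sub, AddSubgroupClass.coe_nsmul]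
    rw [smul_sub, smul_sub, pow_add 2 (δ.k + δ'.k) e, mul_smul (2 ^ (δ.k + δ'.k)) (2 ^ e) (P i), hPe i, smul_zero, sub_zero,
      smul_smul, smul_smul, e1, e2]
  have ht := congrArg t hid
  rw [map_sub, map_nsmul, map_nsmul, map_nsmul, nsmul_eq_mul, nsmul_eq_mul, nsmul_eq_mul] at ht
  push_cast at ht
  unfold LocalKummerDatum.val
  refine PlusValue.levelValue_eq_of_pow_mul_sub_mem (p := 2) δ.k δ'.k e _ _ ?_
  simp only [Nat.cast_ofNat] at ht ⊢
  rw [ht]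
  exact Ideal.mul_mem_right _ _ (Ideal.mem_span_singleton_self _)


/-! ## §2c H1loc (PROVED): every LOCAL class has a local Θ-Kummer datum — LOCAL port of p695679 `exists_towerKummer_of_cocycle` -/

/-- The `i`-th coordinate map `a ↦ ι_*Θ(a)_i : A_ρ →+ E(K̄_v)`. [cite: Kobayashi2003, (8.23) (p. 18)] -/
def coordMap (i : Fin n) : Cofree ρ ↥(padicCoeffField S) →+ localPoints W (v.adicCompletion ℚ) :=
  ((pointsMapOfEmb W (closureEmb (K := ℚ) (v.adicCompletion ℚ))).comp (W.geomPrimaryTorsion 2).subtype).comp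
    ((Pi.evalAddMonoidHom (fun _ : Fin n => ↥(W.geomPrimaryTorsion 2)) i).comp (Θ v hv).toAddMonoidHom)

/-- Unfolding `coordMap`. [folklore] -/
theorem coordMap_apply (i : Fin n) (a : Cofree ρ ↥(padicCoeffField S)) :
    coordMap (Θ := Θ) (hv := hv) i a = pointsMapOfEmb W (closureEmb (K := ℚ) (v.adicCompletion ℚ)) ((Θ v hv a i : ↥(W.geomPrimaryTorsion 2)) : W.geomPoints) :=
  rfl

/-- `coordMap` is `U_{∞,v}`-equivariant (Θ commutes with the decomposition group, `pointsMapOfEmb_smul`). [cite: Kobayashi2003, (8.23) (p. 18)] -/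
theorem coordMap_smul
    (hΘv : ∀ (δ : absoluteGaloisGroup (v.adicCompletion ℚ)) (m : Cofree ρ ↥(padicCoeffField S)) (i : Fin n),
      Θ v hv (resGalOfEmb (closureEmb (K := ℚ) (v.adicCompletion ℚ)) δ • m) i = resGalOfEmb (closureEmb (K := ℚ) (v.adicCompletion ℚ)) δ • Θ v hv m i)
    (i : Fin n) (τ : absoluteGaloisGroup (v.adicCompletion ℚ)) (a : Cofree ρ ↥(padicCoeffField S)) :
    coordMap (Θ := Θ) (hv := hv) i (resGalOfEmb (closureEmb (K := ℚ) (v.adicCompletion ℚ)) τ • a) = τ • coordMap (Θ := Θ) (hv := hv) i a := by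
  rw [coordMap_apply, coordMap_apply, hΘv, ← pointsMapOfEmb_smul]
  rfl

/-- The coordinate map as a morphism of topological `U_{∞,v}`-representations `A_ρ| ⟶ E(K̄_v)` (discrete both sides). [folklore] -/
def coordHom
    (hΘv : ∀ (δ : absoluteGaloisGroup (v.adicCompletion ℚ)) (m : Cofree ρ ↥(padicCoeffField S)) (i : Fin n),
      Θ v hv (resGalOfEmb (closureEmb (K := ℚ) (v.adicCompletion ℚ)) δ • m) i = resGalOfEmb (closureEmb (K := ℚ) (v.adicCompletion ℚ)) δ • Θ v hv m i)
    (i : Fin n) :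
    subgroupRep (localRepOf (cofreeGaloisModule S ρ) v) (kerGroup κ v) ⟶ discreteTopRep ↥(kerGroup κ v) (localPoints W (v.adicCompletion ℚ)) :=
  TopRep.ofHom
    { toLinearMap := (coordMap (Θ := Θ) (hv := hv) i).toIntLinearMap
      cont := continuous_of_discreteTopology
      isIntertwining' := fun τ => by
        ext a
        exact coordMap_smul hΘv i (τ : absoluteGaloisGroup (v.adicCompletion ℚ)) a }

/-- **H1loc (PROVED): EVERY local class at `v ∣ 2` has a local Θ-Kummer datum** — on the habitat (`GoodSS W 2`, `κ` cyclotomic): a local cocycle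
`ψ` of the COMPACT group `U_{∞,v}` dies under `2^E` (`exists_pow_smul_localCocycle_eq_zero`); its coordinate push-forwards to `E(K̄_v)` are
`2^E`-torsion classes in `H¹(U_{∞,v}, E)`, hence zero by §0 of p695679 (`discreteH1_localPoints_eq_zero_of_pow_nsmul_eq_zero'`, Coates–Greenberg);
read off `Q`, and `2^E Q ∈ E(ℚ_{∞,v})`. This is the sentence "every local class has such a datum" of the `AtTwoPins` docstring, for LOCAL classes
(p695679 §1 states it for restrictions of GLOBAL cocycles only). [cite: GreenbergLNM1716, §2 pp. 83–84] [cite: CoatesGreenberg1996, Cor. 3.2] -/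
theorem LocalKummerDatum.exists_cls_eq [W.IsElliptic] [W.IsGloballyMinimal] (hGood : Rank1Residual.GoodSS W 2) (hκ : κ.IsCyclotomic)
    (hΘv : ∀ (δ : absoluteGaloisGroup (v.adicCompletion ℚ)) (m : Cofree ρ ↥(padicCoeffField S)) (i : Fin n),
      Θ v hv (resGalOfEmb (closureEmb (K := ℚ) (v.adicCompletion ℚ)) δ • m) i = resGalOfEmb (closureEmb (K := ℚ) (v.adicCompletion ℚ)) δ • Θ v hv m i)
    (y : Dloc S κ ρ v) : ∃ δ : LocalKummerDatum S κ ρ W n Θ v hv, δ.cls = y := by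
  obtain ⟨ψ, rfl⟩ := oneCocycleClass_surjective _ y
  -- habitat at `v ∋ 2`
  have hgood : W.HasGoodReductionAt v := W.hasGoodReductionAt_of_hasGoodReductionAtPrime v hv hGood.1
  have hss : ¬ W.HasUnitRootAt v := by
    rw [W.hasUnitRootAt_iff_not_dvd_frobeniusTrace v Nat.prime_two hv, not_not]; exact hGood.2
  -- one exponent kills `ψ`
  obtain ⟨E, hE⟩ := exists_pow_smul_localCocycle_eq_zero (κ := κ) (v := v) (Θ v hv) ψ
  -- the transported local cocycles `P i = coordMap_i ∘ ψ` are `2^E`-torsion, hence null by §0 of p695679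
  let P : Fin n → contOneCocycles (discreteTopRep ↥(kerGroup κ v) (localPoints W (v.adicCompletion ℚ))) := fun i =>
    contOneCocycles.pullback (ContinuousMonoidHom.id _) (resIdHom (coordHom (κ := κ) hΘv i)) ψ
  have hPval : ∀ i τ, (P i).1 τ = coordMap (Θ := Θ) (hv := hv) i (ψ.1 τ) := fun _ _ => rfl
  have hP : ∀ i, (2 ^ E) • P i = 0 := fun i => by
    refine Subtype.ext (ContinuousMap.ext fun τ => ?_)
    change (2 ^ E) • (P i).1 τ = (0 : localPoints W (v.adicCompletion ℚ))
    rw [hPval, ← map_nsmul, hE τ, map_zero]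
  have h2m : ∀ i, (2 ^ E) • oneCocycleClass _ (P i) = 0 := fun i => by
    have e := map_nsmul (oneCocycleClassₗ (discreteTopRep ↥(kerGroup κ v) (localPoints W (v.adicCompletion ℚ)))) (2 ^ E) (P i)
    rw [hP i, map_zero] at e
    exact e.symm
  have hzero : ∀ i, oneCocycleClass _ (P i) = 0 := fun i =>
    ThetaTransport.CofreeSelmerTransfer.discreteH1_localPoints_eq_zero_of_pow_nsmul_eq_zero' W κ hκ hv hgood hss E _ (h2m i)
  -- read off the Kummer representatives
  have hQ : ∀ i, ∃ q : localPoints W (v.adicCompletion ℚ), ∀ τ : ↥(kerGroup κ v),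
      coordMap (Θ := Θ) (hv := hv) i (ψ.1 τ) = (τ : absoluteGaloisGroup (v.adicCompletion ℚ)) • q - q := fun i => by
    obtain ⟨q, hq⟩ := (oneCocycleClass_eq_zero_iff _ (P i)).mp (hzero i)
    exact ⟨q, fun τ => by rw [← hPval]; exact hq τ⟩
  choose Q hQ using hQ
  refine ⟨⟨ψ, Q, E, fun i => ?_, fun τ i => hQ i τ⟩, rfl⟩
  rw [Sprung2012.mem_localTowerPointsOfEmb_iff]
  intro τ hτ
  have h2 : (2 ^ E) • coordMap (Θ := Θ) (hv := hv) i (ψ.1 ⟨τ, hτ⟩) = 0 := by rw [← map_nsmul, hE, map_zero]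
  rw [hQ i ⟨τ, hτ⟩, smul_sub, sub_eq_zero, smul_comm] at h2
  exact h2


/-! ## §2d (O-inst, PROVED): the binder `ℤ₂`-structure on `D_w` pinned to the functorial action EXISTS — constructed from `DlocSMul` (a `def`, no instance) -/

/-- `ι(1) ∘ ψ = ψ`. [folklore] -/
theorem smulCocycle_one (ψ : contOneCocycles (subgroupRep (localRepOf (cofreeGaloisModule S ρ) v) (kerGroup κ v))) :
    smulCocycle (κ := κ) (v := v) 1 ψ = ψ :=
  Subtype.ext (ContinuousMap.ext fun τ => by
    change (1 : ↥(padicCoeffIntegers S)) • ψ.1 τ = ψ.1 τ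
    exact one_smul _ _)

/-- `ι(ab) ∘ ψ = ι(a) ∘ (ι(b) ∘ ψ)`. [folklore] -/
theorem smulCocycle_mul (a b : ↥(padicCoeffIntegers S)) (ψ : contOneCocycles (subgroupRep (localRepOf (cofreeGaloisModule S ρ) v) (kerGroup κ v))) :
    smulCocycle (κ := κ) (v := v) (a * b) ψ = smulCocycle (κ := κ) (v := v) a (smulCocycle (κ := κ) (v := v) b ψ) :=
  Subtype.ext (ContinuousMap.ext fun τ => by
    change (a * b) • ψ.1 τ = a • b • ψ.1 τ
    exact mul_smul _ _ _)

/-- `ι(a+b) ∘ ψ = ι(a) ∘ ψ + ι(b) ∘ ψ`. [folklore] -/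
theorem smulCocycle_add (a b : ↥(padicCoeffIntegers S)) (ψ : contOneCocycles (subgroupRep (localRepOf (cofreeGaloisModule S ρ) v) (kerGroup κ v))) :
    smulCocycle (κ := κ) (v := v) (a + b) ψ = smulCocycle (κ := κ) (v := v) a ψ + smulCocycle (κ := κ) (v := v) b ψ :=
  Subtype.ext (ContinuousMap.ext fun τ => by
    change (a + b) • ψ.1 τ = a • ψ.1 τ + b • ψ.1 τ
    exact add_smul _ _ _)

/-- `ι(0) ∘ ψ = 0`. [folklore] -/
theorem smulCocycle_zero (ψ : contOneCocycles (subgroupRep (localRepOf (cofreeGaloisModule S ρ) v) (kerGroup κ v))) :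
    smulCocycle (κ := κ) (v := v) 0 ψ = 0 :=
  Subtype.ext (ContinuousMap.ext fun τ => by
    change (0 : ↥(padicCoeffIntegers S)) • ψ.1 τ = 0
    exact zero_smul _ _)

variable (S κ ρ v) in
/-- **(O-inst) THE BINDER `ℤ₂`-STRUCTURE ON `D_v`, CONSTRUCTED**: `a • y := DlocSMul (ι a) y` IS a module structure (functoriality of `H¹` read on
cocycle representatives via `DlocSMul_oneCocycleClass`). A `def`, never an instance (frame discipline); the split texts' binder
`[Module ℤ_[2] (Dloc …)]` + pin `hD₂` are satisfiable by `letI := dlocModule …` and `rfl`. [cite: Greenberg1989, §1 p. 98] -/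
@[reducible]
def dlocModule : Module ℤ_[2] (Dloc S κ ρ v) where
  smul a y := DlocSMul S κ ρ v (padicIntToCoeffIntegers S a) y
  one_smul y := by
    obtain ⟨ψ, rfl⟩ := oneCocycleClass_surjective _ y
    show DlocSMul S κ ρ v (padicIntToCoeffIntegers S 1) _ = _
    rw [map_one, DlocSMul_oneCocycleClass, smulCocycle_one]
  mul_smul a b y := by
    obtain ⟨ψ, rfl⟩ := oneCocycleClass_surjective _ y
    show DlocSMul S κ ρ v (padicIntToCoeffIntegers S (a * b)) _ =
      DlocSMul S κ ρ v (padicIntToCoeffIntegers S a) (DlocSMul S κ ρ v (padicIntToCoeffIntegers S b) _)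
    rw [map_mul, DlocSMul_oneCocycleClass, DlocSMul_oneCocycleClass, DlocSMul_oneCocycleClass, smulCocycle_mul]
  smul_zero a := by
    show DlocSMul S κ ρ v (padicIntToCoeffIntegers S a) 0 = 0
    exact map_zero _
  smul_add a y y' := by
    show DlocSMul S κ ρ v (padicIntToCoeffIntegers S a) (y + y') = DlocSMul S κ ρ v (padicIntToCoeffIntegers S a) y + DlocSMul S κ ρ v (padicIntToCoeffIntegers S a) y'
    exact map_add _ _ _
  add_smul a b y := by
    obtain ⟨ψ, rfl⟩ := oneCocycleClass_surjective _ y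
    show DlocSMul S κ ρ v (padicIntToCoeffIntegers S (a + b)) _ =
      DlocSMul S κ ρ v (padicIntToCoeffIntegers S a) _ + DlocSMul S κ ρ v (padicIntToCoeffIntegers S b) _
    rw [map_add, DlocSMul_oneCocycleClass, DlocSMul_oneCocycleClass, DlocSMul_oneCocycleClass, smulCocycle_add, oneCocycleClass_add]
  zero_smul y := by
    obtain ⟨ψ, rfl⟩ := oneCocycleClass_surjective _ y
    show DlocSMul S κ ρ v (padicIntToCoeffIntegers S 0) _ = 0
    rw [map_zero, DlocSMul_oneCocycleClass, smulCocycle_zero, oneCocycleClass_zero]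

/-- The pin `hD₂` holds for `dlocModule` by `rfl`. [folklore] -/
theorem dlocModule_smul_eq (a : ℤ_[2]) (y : Dloc S κ ρ v) :
    (letI := dlocModule S κ ρ v; a • y) = DlocSMul S κ ρ v (padicIntToCoeffIntegers S a) y :=
  rfl

/-! ## §3 PACKAGING (PROVED): `hD₂ + H1loc + H2loc ⟹ Nonempty (AtTwoPins … π)` — the binder of the EH / S4₂ split texts is instantiable -/

variable [W.IsElliptic] (S₀ : Finset (HeightOneSpectrum (𝓞 ℚ))) (γ : absoluteGaloisGroup ℚ)
  (hΘ : ∀ v hv (δ : absoluteGaloisGroup (v.adicCompletion ℚ)) m i,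
    Θ v hv (resGalOfEmb (closureEmb (K := ℚ) (v.adicCompletion ℚ)) δ • m) i = resGalOfEmb (closureEmb (K := ℚ) (v.adicCompletion ℚ)) δ • Θ v hv m i)
  (I : Kato2004.IwasawaH1DataCoeff (FramedGaloisRep.toGaloisRep ρ) 2 κ γ)
  (Sg : AddSubgroup (subgroupH1 κ.kerSubgroup (Cofree ρ ↥(padicCoeffField S)))) [Module ↥(padicCoeffIntegers S) ↥Sg]
  (π : OnePairPins S W κ γ S₀ n ρ Θ hΘ I Sg) [Module ℤ_[2] (Dloc S κ ρ π.v)]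

/-- **THE PROPOSED STEP, PROVED MODULO THE TWO LOCAL PORTS.** Given the binder `ℤ₂`-structure pinned to the functorial action (`hD₂`), the EXISTENCE of
a local Θ-Kummer datum for every local class (H1loc — LOCAL port of p695679 `exists_towerKummer_of_cocycle`) and the WELL-DEFINEDNESS of the level
value on a local class (H2loc — LOCAL port of `PlusValue.levelValue_eq_of_kummerData`), the pin bundle `AtTwoPins π` is inhabited: `c₂` descends by
§1 (additivity in `y` from H3loc `LocalKummerDatum.add_val`, in `t` from `val_add`), `hc₂_smul` from H4loc `exists_smul` + `hD₂`, `hc₂` = the descent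
rule. [cite: Kobayashi2003, Thm. 6.2 and (8.23) (p. 18)] [cite: PerrinRiou1994Invent, §3.6.1] [cite: MilneADT2006, Ch. I §6] -/
theorem nonempty_atTwoPins_of_parts
    (hD₂ : ∀ (a : ℤ_[2]) (y : Dloc S κ ρ π.v), a • y = DlocSMul S κ ρ π.v (padicIntToCoeffIntegers S a) y)
    (H1 : ∀ y : Dloc S κ ρ π.v, ∃ δ : LocalKummerDatum S κ ρ W n Θ π.v π.hv, δ.cls = y)
    (H2 : ∀ (t : (Fin n → ↥(Sprung2012.localTowerPointsOfEmb κ (closureEmb (K := ℚ) (π.v.adicCompletion ℚ)) W)) →+ ℤ_[2])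
      (δ δ' : LocalKummerDatum S κ ρ W n Θ π.v π.hv), δ.cls = δ'.cls → δ.val t = δ'.val t) :
    Nonempty (AtTwoPins S κ ρ S₀ W γ n Θ hΘ I Sg π) := by
  obtain ⟨c, hc⟩ := exists_biadditive_of_datum
    (F := (Fin n → ↥(Sprung2012.localTowerPointsOfEmb κ (closureEmb (K := ℚ) (π.v.adicCompletion ℚ)) W)) →+ ℤ_[2])
    (V := AddCircle (1 : ℚ))
    (fun (y : Dloc S κ ρ π.v) (δ : LocalKummerDatum S κ ρ W n Θ π.v π.hv) => δ.cls = y) (fun t δ => δ.val t) H1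
    (fun t y δ δ' h h' => H2 t δ δ' (h.trans h'.symm))
    (fun y y' δ δ' h h' => ⟨δ.add δ', by rw [LocalKummerDatum.cls_add, h, h'], fun t => LocalKummerDatum.add_val δ δ' t⟩)
    (fun t t' y δ _ => δ.val_add t t')
  refine ⟨{ hD₂ := hD₂
            c₂ := AddMonoidHom.mk' (fun t => (c t : CharacterModule (Dloc S κ ρ π.v))) (fun t t' => map_add c t t')
            hc₂_smul := fun a t y => ?_
            hc₂ := fun t y ψ Q k hQ hcls hK => hc t y ⟨ψ, Q, k, hQ, hK⟩ hcls }⟩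
  obtain ⟨δ, hδ⟩ := H1 y
  obtain ⟨δ', hδ'cls, hδ'val⟩ := LocalKummerDatum.exists_smul (hv := π.hv) a t δ
  show c (a • t) y = c t (a • y)
  rw [hc (a • t) y δ hδ, hc t (a • y) δ' (by rw [hδ'cls, hδ, hD₂]), hδ'val]

/-- **THE PROPOSED STEP WITH ONE HYPOTHESIS LEFT**: `hD₂ + H1loc ⟹ Nonempty (AtTwoPins … π)` — H2loc is DISCHARGED by §2b
(`LocalKummerDatum.val_eq_of_cls_eq`, fed with the frame's `hΘ` at `π.v`). The only remaining port is H1loc (existence of a local Θ-Kummer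
datum for every LOCAL class; p695679 §1 proves it for GLOBAL cocycles). [cite: Kobayashi2003, Thm. 6.2 and (8.23) (p. 18)] [cite: MilneADT2006, Ch. I §6] -/
theorem nonempty_atTwoPins_of_exists_datum
    (hD₂ : ∀ (a : ℤ_[2]) (y : Dloc S κ ρ π.v), a • y = DlocSMul S κ ρ π.v (padicIntToCoeffIntegers S a) y)
    (H1 : ∀ y : Dloc S κ ρ π.v, ∃ δ : LocalKummerDatum S κ ρ W n Θ π.v π.hv, δ.cls = y) :
    Nonempty (AtTwoPins S κ ρ S₀ W γ n Θ hΘ I Sg π) :=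
  nonempty_atTwoPins_of_parts S₀ γ hΘ I Sg π hD₂ H1 fun t δ δ' h => LocalKummerDatum.val_eq_of_cls_eq (hΘ π.v π.hv) t δ δ' h

/-- **THE BINDER IS INSTANTIABLE (PROVED OUTRIGHT on the habitat).** For `W` good supersingular at `2`, `κ` cyclotomic, and the binder
`ℤ₂`-structure on `D₂` pinned to the functorial action (`hD₂` — the one field the caller supplies together with the instance), the pin bundle
`AtTwoPins π` of the EH / S4₂ split texts is inhabited: `c₂` exists (and is unique, `atTwoPins_c₂_eq`). H1loc = `exists_cls_eq`, H2loc =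
`val_eq_of_cls_eq`, H3loc = `add_val`, H4loc = `exists_smul`, glue = §1. BSD is not proved by this; RSL_g stays OPEN.
[cite: Kobayashi2003, Thm. 6.2 and (8.23) (p. 18)] [cite: CoatesGreenberg1996, Cor. 3.2] [cite: MilneADT2006, Ch. I §6] -/
theorem nonempty_atTwoPins [W.IsGloballyMinimal] (hGood : Rank1Residual.GoodSS W 2) (hκ : κ.IsCyclotomic)
    (hD₂ : ∀ (a : ℤ_[2]) (y : Dloc S κ ρ π.v), a • y = DlocSMul S κ ρ π.v (padicIntToCoeffIntegers S a) y) :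
    Nonempty (AtTwoPins S κ ρ S₀ W γ n Θ hΘ I Sg π) :=
  nonempty_atTwoPins_of_exists_datum S₀ γ hΘ I Sg π hD₂ (LocalKummerDatum.exists_cls_eq hGood hκ (hΘ π.v π.hv))

/-- **… and its `c₂` is THE local value character**: unique among all `AtTwoPins` bundles over the same binder instance. [folklore] -/
theorem atTwoPins_subsingleton_c₂ [W.IsGloballyMinimal] (hGood : Rank1Residual.GoodSS W 2) (hκ : κ.IsCyclotomic)
    (π₂ π₂' : AtTwoPins S κ ρ S₀ W γ n Θ hΘ I Sg π) : π₂.c₂ = π₂'.c₂ :=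
  AddMonoidHom.ext fun t => DFunLike.ext _ _ fun y => (LocalKummerDatum.exists_cls_eq hGood hκ (hΘ π.v π.hv) y).elim fun δ h =>
    (π₂.hc₂ t y δ.ψ δ.Q δ.k δ.hQ h δ.hK).trans (π₂'.hc₂ t y δ.ψ δ.Q δ.k δ.hQ h δ.hK).symm

omit [Module ℤ_[2] (Dloc S κ ρ π.v)] in
/-- **BOTTOM LINE (PROVED, NO BINDER LEFT): the `π₂ : AtTwoPins π` binder of the EH / S4₂ split texts is instantiable on the habitat** — with the
CONSTRUCTED `ℤ₂`-structure `dlocModule` (pin `hD₂` by `rfl`) and the local value character of §3. What `onePairSupply_of_split` / the lead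
needs in order to feed `π₂` to the split texts; the remaining mathematics is IN those texts (EH, S4₂), not in the frame. BSD is not proved by this.
[cite: Kobayashi2003, Thm. 6.2 and (8.23) (p. 18)] [cite: CoatesGreenberg1996, Cor. 3.2] [cite: Greenberg1989, §1 p. 98] -/
theorem nonempty_atTwoPins_dlocModule [W.IsGloballyMinimal] (hGood : Rank1Residual.GoodSS W 2) (hκ : κ.IsCyclotomic) :
    Nonempty (letI := dlocModule S κ ρ π.v; AtTwoPins S κ ρ S₀ W γ n Θ hΘ I Sg π) := by
  letI := dlocModule S κ ρ π.v
  exact nonempty_atTwoPins S₀ γ hΘ I Sg π hGood hκ fun _ _ => rfl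

/-! ## §4 UNIQUENESS (PROVED): the value pin determines `c₂` (given H1loc) — two `AtTwoPins` bundles have the same local value character -/

/-- **`c₂` is unique.** [cite: Kobayashi2003, (8.23) (p. 18)] -/
theorem atTwoPins_c₂_eq (H1 : ∀ y : Dloc S κ ρ π.v, ∃ δ : LocalKummerDatum S κ ρ W n Θ π.v π.hv, δ.cls = y)
    (π₂ π₂' : AtTwoPins S κ ρ S₀ W γ n Θ hΘ I Sg π) : π₂.c₂ = π₂'.c₂ :=
  AddMonoidHom.ext fun t => DFunLike.ext _ _ fun y => (H1 y).elim fun δ h =>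
    (π₂.hc₂ t y δ.ψ δ.Q δ.k δ.hQ h δ.hK).trans (π₂'.hc₂ t y δ.ψ δ.Q δ.k δ.hQ h δ.hK).symm

/-- **Every `AtTwoPins` bundle evaluates by the level value on every local datum** (restated in datum form, for the EH / S4₂ provers). [folklore] -/
theorem atTwoPins_c₂_apply (π₂ : AtTwoPins S κ ρ S₀ W γ n Θ hΘ I Sg π)
    (t : (Fin n → ↥(Sprung2012.localTowerPointsOfEmb κ (closureEmb (K := ℚ) (π.v.adicCompletion ℚ)) W)) →+ ℤ_[2])
    (y : Dloc S κ ρ π.v) (δ : LocalKummerDatum S κ ρ W n Θ π.v π.hv) (h : δ.cls = y) : π₂.c₂ t y = δ.val t :=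
  π₂.hc₂ t y δ.ψ δ.Q δ.k δ.hQ h δ.hK

/-! ## §5 T1 (f) of GLUE-SPEC-g18 (PROVED, the `c₂` half): on the localisation of a GLOBAL class, `c₂` takes the S2 value of any GLOBAL tower-Kummer
datum — the bridge `locKer_oneCocycleClass` (p700007) turns the global datum into a LOCAL Θ-Kummer datum of `loc₂ s`. -/

/-- A GLOBAL tower-Kummer datum `(φ, Q, k)` of a global class (p695679 `exists_towerKummer_of_cocycle` shape, `τ` read in `U_{∞,v}` through
`resGalSubgroupOfEmb`) IS a local Θ-Kummer datum of its localisation `locKer [φ]` (pull-back cocycle; values by `locKer_pullback_apply`).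
[cite: SerreGaloisCohomology1997, I §2.4] -/
def LocalKummerDatum.ofGlobal (φ : contOneCocycles (subgroupRep (cofreeGaloisModule S ρ).toTopRep κ.kerSubgroup))
    (Q : Fin n → localPoints W (v.adicCompletion ℚ)) (k : ℕ)
    (hQ : ∀ i, (2 ^ k) • Q i ∈ Sprung2012.localTowerPointsOfEmb κ (closureEmb (K := ℚ) (v.adicCompletion ℚ)) W)
    (hK : ∀ (τ : ↥(kerGroup κ v)) (i : Fin n),
      pointsMapOfEmb W (closureEmb (K := ℚ) (v.adicCompletion ℚ))
        ((Θ v hv (φ.1 (resGalSubgroupOfEmb κ.kerSubgroup (closureEmb (K := ℚ) (v.adicCompletion ℚ)) τ)) i : ↥(W.geomPrimaryTorsion 2)) : W.geomPoints) =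
          (τ : absoluteGaloisGroup (v.adicCompletion ℚ)) • Q i - Q i) :
    LocalKummerDatum S κ ρ W n Θ v hv where
  ψ := contOneCocycles.pullback (resGalSubgroupOfEmb κ.kerSubgroup (closureEmb (K := ℚ) (v.adicCompletion ℚ)))
        (X := subgroupRep (cofreeGaloisModule S ρ).toTopRep κ.kerSubgroup) (Y := subgroupRep (localRepOf (cofreeGaloisModule S ρ) v) (kerGroup κ v))
        (TopRep.ofHom ⟨ContinuousLinearMap.id ℤ (Cofree ρ ↥(padicCoeffField S)), fun _ ↦ rfl⟩) φ
  Q := Q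
  k := k
  hQ := hQ
  hK := fun τ i => by rw [ThetaTransport.locKer_pullback_apply]; exact hK τ i

omit [W.IsElliptic] in
/-- Its class is `loc₂ [φ]`. (p700007 `locKer_oneCocycleClass`.) [cite: SerreGaloisCohomology1997, I §2.4] -/
theorem LocalKummerDatum.cls_ofGlobal (φ : contOneCocycles (subgroupRep (cofreeGaloisModule S ρ).toTopRep κ.kerSubgroup))
    (Q : Fin n → localPoints W (v.adicCompletion ℚ)) (k : ℕ)
    (hQ : ∀ i, (2 ^ k) • Q i ∈ Sprung2012.localTowerPointsOfEmb κ (closureEmb (K := ℚ) (v.adicCompletion ℚ)) W)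
    (hK : ∀ (τ : ↥(kerGroup κ v)) (i : Fin n),
      pointsMapOfEmb W (closureEmb (K := ℚ) (v.adicCompletion ℚ))
        ((Θ v hv (φ.1 (resGalSubgroupOfEmb κ.kerSubgroup (closureEmb (K := ℚ) (v.adicCompletion ℚ)) τ)) i : ↥(W.geomPrimaryTorsion 2)) : W.geomPoints) =
          (τ : absoluteGaloisGroup (v.adicCompletion ℚ)) • Q i - Q i) :
    (LocalKummerDatum.ofGlobal (hv := hv) φ Q k hQ hK).cls = locKer S κ ρ v (oneCocycleClass _ φ) :=
  (ThetaTransport.locKer_oneCocycleClass S κ ρ v φ).symm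

/-- **T1 (f), `c₂` half (PROVED): `c₂ t (loc₂ [φ]) = (t(2^kQ) mod 2^k)·2^{-k}` for every GLOBAL tower-Kummer datum `(φ, Q, k)`** — the same
registered VALUE the S2 plus pairing `pair₂ t [φ]` takes (`PlusPair.exists_plusPair`, clause VAL); hence `pair₂ t s = π₂.c₂ t (loc₂ s)` on `Sg`
once both are fed the same datum (GLUE-SPEC-g18 §1 T1 (f)). [cite: Kobayashi2003, Thm. 6.2 and (8.23) (p. 18)] [cite: GreenbergLNM1716, §2 pp. 83–84] -/
theorem atTwoPins_c₂_locKer_eq (π₂ : AtTwoPins S κ ρ S₀ W γ n Θ hΘ I Sg π)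
    (t : (Fin n → ↥(Sprung2012.localTowerPointsOfEmb κ (closureEmb (K := ℚ) (π.v.adicCompletion ℚ)) W)) →+ ℤ_[2])
    (φ : contOneCocycles (subgroupRep (cofreeGaloisModule S ρ).toTopRep κ.kerSubgroup))
    (Q : Fin n → localPoints W (π.v.adicCompletion ℚ)) (k : ℕ)
    (hQ : ∀ i, (2 ^ k) • Q i ∈ Sprung2012.localTowerPointsOfEmb κ (closureEmb (K := ℚ) (π.v.adicCompletion ℚ)) W)
    (hK : ∀ (τ : ↥(kerGroup κ π.v)) (i : Fin n),
      pointsMapOfEmb W (closureEmb (K := ℚ) (π.v.adicCompletion ℚ))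
        ((Θ π.v π.hv (φ.1 (resGalSubgroupOfEmb κ.kerSubgroup (closureEmb (K := ℚ) (π.v.adicCompletion ℚ)) τ)) i : ↥(W.geomPrimaryTorsion 2)) : W.geomPoints) =
          (τ : absoluteGaloisGroup (π.v.adicCompletion ℚ)) • Q i - Q i) :
    π₂.c₂ t (locKer S κ ρ π.v (oneCocycleClass _ φ)) =
      (PadicInt.toZModPow k (t (fun i => ⟨(2 ^ k) • Q i, hQ i⟩))).val • ((((2 : ℚ) ^ k)⁻¹ : ℚ) : AddCircle (1 : ℚ)) :=
  let δ := LocalKummerDatum.ofGlobal (S := S) (κ := κ) (ρ := ρ) (W := W) (n := n) (Θ := Θ) (hv := π.hv) φ Q k hQ hK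
  π₂.hc₂ t _ δ.ψ δ.Q δ.k δ.hQ (LocalKummerDatum.cls_ofGlobal (hv := π.hv) φ Q k hQ hK) δ.hK

end Local

end Summit.BirchSwinnertonDyer.BirchSwinnertonDyer.Cruxes.ResidualThetaCountLowerPureAtTwo.SideaK3G17

end
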